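import Summits.BirchSwinnertonDyer.BirchSwinnertonDyer.Theorems.Rank1ResidualJetRowDualityCarrier
import HarnessLib

/-!
# T1 JET (cell `bsd-jet`), road K, input (L1) REDUCED: the Kolyvagin-prime local term of the row
# duality only sees the SINGULAR QUOTIENT — `[X^s : A ∩ X^s] = #(X/A)^s` for an involution and odd
# exponent (pure algebra), applied to `X = H¹(K_λ, E[p^k])`, `A = Kum_λ`, `σ_{*,λ}`

HONEST FRAMING (programme file `BSD-LIT2PART-PROGRAMME-v1.md` §HONESTY, verbatim): «no tranche here
proves BSD; ARM L moves the LITERAL column of an r ≤ 1 census into the kernel-proved-modulo-named-print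
column; ARM P changes what «named print» is worth.» THEOREMS ONLY (seat `bsd-jet-pv-1`, session g5;
`--supports stmt-BirchSwinnertonDyer-14418`, helper): no definition, no named fact, no `sorry`.
Nothing is booked; 0 classes move.

## What

The local term `hloc` of `GlobalDuality.exists_rowDuality[_modified]` /
`JET.tamagawaExponent_le_mInfty_of_kernelInputs_duality ∕ _weil` is
`(Kum_λ).relIndex (ker(σ_{*,λ} − s)) = p^k` at the prime `λ` of `K` above a Kolyvagin prime. This
file shows that for a finite group `X` killed by an odd `N`, an involution `τ` of `X` and a `τ`-stable
`A ≤ X`, and either sign `s = ±1`,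

`A.relIndex (ker(τ − s)) = #ker(τ̄ − s)`, `τ̄` the involution induced on `X/A`

(`relIndex_ker_eq_natCard_ker_quotientMap`: the `s`-eigenclasses of `X` map ONTO those of `X/A` — lift
`y` to `m(x + sτx)`, `2m = N + 1` — with kernel `A ∩ X^s`). Hence `hloc` is EQUIVALENT to Jetchev's
Lemma 5.2 (ii) in the form «the `s`-part of the singular quotient `H¹(K_λ, E[p^k])/H¹_f` under
`σ_{*,λ}` has order `p^k`» (`relIndex_kummer_ker_conjActPlace_eq`), and the unramified part
`H¹_f = Kum_λ` (Lemma 5.2 (i)) drops out of the row duality altogether.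

References (locators only; no cited FACT is declared): [cite: Jetchev2008, Lemma 5.2 (i)–(ii) (p. 822)]
[cite: MilneADT2006, Ch. I §0]. Design: no definitions; `Type*`-polymorphic algebra, `K : Type u` for
the application. Axioms: `propext`, `Classical.choice`, `Quot.sound`.
-/

set_option autoImplicit false

noncomputable section

open scoped Classical
open Function NumberField IsDedekindDomain WeierstrassCurve Field
open Literature.NumberTheory.EllipticCurves Literature.NumberTheory.GaloisRepresentations
open Literature.NumberTheory.GaloisRepresentations.DiscreteGaloisModule (SelmerStructure)

universe u

namespace Summit.BirchSwinnertonDyer.Rank1Residual.JET.GlobalDuality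

/-! ### Eigenclasses of an involution pass to quotients (odd exponent) -/

section EigenQuotient

variable {X : Type*} [AddCommGroup X] (τ : X →+ X) (A : AddSubgroup X)

/-- **`[X^s : A ∩ X^s] = #(X/A)^s`** for an involution `τ` of a group `X` killed by an odd `N`, a
`τ`-stable subgroup `A` and `s = ±1`: the projection maps the `s`-eigenclasses of `X` ONTO the
`s`-eigenclasses of the induced involution `τ̄` of `X/A` (lift `y` to `m(x + sτx)` with `2m = N + 1`),
with kernel `A ∩ X^s`. [cite: Jetchev2008, Lemma 5.2 (iii) (p. 822)] [cite: MilneADT2006, Ch. I §0] -/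
theorem relIndex_ker_eq_natCard_ker_quotientMap {N : ℕ} (hN : Odd N) (hX : ∀ x : X, N • x = 0)
    (hτ : ∀ x, τ (τ x) = x) (hA : A ≤ A.comap τ) {s : ℤ} (hs : s = 1 ∨ s = -1) :
    A.relIndex (τ - s • AddMonoidHom.id X).ker =
      Nat.card ((QuotientAddGroup.map A A τ hA - s • AddMonoidHom.id (X ⧸ A)).ker) := by
  have hs2 : s * s = 1 := by rcases hs with rfl | rfl <;> norm_num
  have hmem : ∀ x : X, x ∈ (τ - s • AddMonoidHom.id X).ker ↔ τ x = s • x := fun x => by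
    rw [AddMonoidHom.mem_ker, AddMonoidHom.sub_apply, AddMonoidHom.smul_apply, AddMonoidHom.id_apply,
      sub_eq_zero]
  have hmemq : ∀ y : X ⧸ A, y ∈ (QuotientAddGroup.map A A τ hA - s • AddMonoidHom.id (X ⧸ A)).ker ↔
      QuotientAddGroup.map A A τ hA y = s • y := fun y => by
    rw [AddMonoidHom.mem_ker, AddMonoidHom.sub_apply, AddMonoidHom.smul_apply, AddMonoidHom.id_apply,
      sub_eq_zero]
  -- the projection restricted to `X^s`
  let g : (τ - s • AddMonoidHom.id X).ker →+ X ⧸ A := (QuotientAddGroup.mk' A).comp (AddSubgroup.subtype _)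
  have hker : ∀ x : (τ - s • AddMonoidHom.id X).ker, g x = 0 ↔ (x : X) ∈ A := fun x => by
    simp only [g, AddMonoidHom.comp_apply, QuotientAddGroup.mk'_apply, QuotientAddGroup.eq_zero_iff,
      AddSubgroup.coe_subtype]
  have hrange : g.range = (QuotientAddGroup.map A A τ hA - s • AddMonoidHom.id (X ⧸ A)).ker := by
    apply le_antisymm
    · rintro _ ⟨x, rfl⟩
      rw [hmemq]
      simp only [g, AddMonoidHom.comp_apply, QuotientAddGroup.mk'_apply, AddSubgroup.coe_subtype,
        QuotientAddGroup.map_mk, (hmem x).mp x.2, QuotientAddGroup.mk_zsmul]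
    · intro y hy
      rw [hmemq] at hy
      obtain ⟨x₀, rfl⟩ := QuotientAddGroup.mk_surjective y
      obtain ⟨m, hm⟩ := exists_two_mul_eq_succ_of_odd hN
      -- the averaged lift `m (x₀ + s τ x₀)` is an `s`-eigenclass over `y`
      have hx : τ (m • (x₀ + s • τ x₀)) = s • (m • (x₀ + s • τ x₀)) := by
        rw [map_nsmul, map_add, map_zsmul, hτ, smul_comm s m, smul_add s x₀, smul_smul, hs2, one_smul,
          add_comm]
      refine ⟨⟨m • (x₀ + s • τ x₀), (hmem _).mpr hx⟩, ?_⟩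
      simp only [g, AddMonoidHom.comp_apply, QuotientAddGroup.mk'_apply, AddSubgroup.coe_subtype]
      rw [QuotientAddGroup.mk_nsmul, QuotientAddGroup.mk_add, QuotientAddGroup.mk_zsmul,
        ← QuotientAddGroup.map_mk A A τ hA, hy, smul_smul, hs2, one_smul, ← two_nsmul,
        ← eq_nsmul_two_nsmul hm (fun z : X ⧸ A => ?_)]
      obtain ⟨z, rfl⟩ := QuotientAddGroup.mk_surjective z
      rw [← QuotientAddGroup.mk_nsmul, hX, QuotientAddGroup.mk_zero]
  rw [← natCard_range_eq_relIndex g hker, hrange]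

end EigenQuotient

/-! ### The Kolyvagin-prime local term only sees the singular quotient -/

section LocalTerm

variable {K : Type u} [Field K] [NumberField K] (W : WeierstrassCurve ℚ) (σ : K ≃ₐ[ℚ] K) (n : ℤ)

/-- **`hloc` reduced to the singular quotient**: at a `σ`-fixed finite place `λ` (`hfix : σ • λ = λ`),
for a level `n` whose absolute value `N` is odd and either sign `s = ±1`,

`(Kum_λ).relIndex (ker(σ_{*,λ} − s)) = #ker(σ̄_{*,λ} − s)` on `H¹(K_λ, E[n]) ⧸ Kum_λ`,

`σ_{*,λ} = conjActPlace W σ n hfix` (an involution for `σ² = 1`, carrying `Kum_λ` into itself) and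
`σ̄_{*,λ}` the induced involution of the singular quotient `H¹(K_λ, E[n])/Kum_λ`. So the local term of
`GlobalDuality.exists_rowDuality` at a Kolyvagin prime is exactly Jetchev's Lemma 5.2 (ii) («`H¹_s^±`
free of rank one over `ℤ/p^k`») and Lemma 5.2 (i) (the unramified part) is not needed.
[cite: Jetchev2008, Lemma 5.2 (i)–(ii) (p. 822)] -/
theorem relIndex_kummer_ker_conjActPlace_eq (hσ : σ * σ = 1) {N : ℕ} (hN : Odd N)
    (hn : ∀ P : geomTorsion (W.baseChange K) n, N • P = 0)
    {l : HeightOneSpectrum (𝓞 K)} (hfix : σ • l = l) {s : ℤ} (hs : s = 1 ∨ s = -1) :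
    ((W.baseChange K).kummerSelmerStructure n (Sum.inr l)).relIndex
        ((conjActPlace W σ n hfix - s • AddMonoidHom.id _).ker) =
      Nat.card ((QuotientAddGroup.map ((W.baseChange K).kummerSelmerStructure n (Sum.inr l))
          ((W.baseChange K).kummerSelmerStructure n (Sum.inr l)) (conjActPlace W σ n hfix)
          (fun _ hx => AddSubgroup.mem_comap.mpr (conjActPlace_mem_kummerSelmerStructure W σ n hfix hx)) -
        s • AddMonoidHom.id _).ker) :=
  relIndex_ker_eq_natCard_ker_quotientMap _ _ hN
    (fun x => galoisCohomology.nsmul_eq_zero_of_forall _ hn x)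
    (conjActPlace_conjActPlace W σ n hσ hfix hfix) _ hs

end LocalTerm

end Summit.BirchSwinnertonDyer.Rank1Residual.JET.GlobalDuality

end
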